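import Literature.Analysis.FluidPDE.LocalEnergySolutionsOn
import Literature.Analysis.FluidPDE.SuitableWeakRescaling
import Literature.Analysis.FluidPDE.LerayFarFieldRegularity
import HarnessLib

/-!
# Local energy solutions on a strip under the viscosity scaling

Analysis/FluidPDE proof file (theorems only, no new definitions or facts), part of the
reduction of the named fact `Literature.Analysis.FluidPDE.lemarieRieusset_prop_15_1`
(Lemarié-Rieusset 2016, Prop. 15.1, every viscosity `ν > 0`) to Seregin–Šverák's existence
theorem for weak `L³`-solutions (`sereginSverak2017_weakL3_exists`, printed with `ν = 1`).
The link is the elementary scaling `v(t, x) = ν V(ν t, x)`, `π(t, x) = ν² Q(ν t, x)`, which maps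
solutions of the Navier–Stokes equations with viscosity `1` on the strip `ℝ³ × (0, νT)` to
solutions with viscosity `ν` on `ℝ³ × (0, T)`, with datum `ν V₀` (Rusin–Šverák 2011, §1;
Tao 2013, footnote 3; the global local-Leray class is `IsLocalLeraySolution.viscosityRescale`,
`LocalLerayViscosityScaling.lean`, the Kato class `KatoViscosityScaling.lean`). This file proves
the same covariance for Seregin's strip class with weak continuity in time,
`IsLocalEnergySolutionOn` (`LocalEnergySolutionsOn.lean`; Seregin 2014, Def. B.1):

* `stPreimage_time_slab_Ioo` — the time dilation `Φ(s, y) = (ν s, y)` pulls the slab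
  `(0, νT) × ℝ³` back to `(0, T) × ℝ³` (boxes `(νa, νb) × B` go to `(a, b) × B`:
  `stAffine_preimage_Ioo_prod`, `LerayFarFieldRegularity.lean`);
* `IsLocalEnergySolutionOn.viscosityRescale` — every clause of Def. B.1 is transported:
  suitability (`IsSuitableWeakSolutionOn.stRescale`, space dilation `1`), the pressure class and
  the decay by the change of variables on boxes, the every-time unit-ball bounds and slice
  measurability slice by slice, the weak spatial gradient (`HasWeakSpatialGradientOn.stRescale`),
  weak continuity on `[0, T]` and the attainment of the datum by composing with `t ↦ ν t`.

## References

* W. Rusin, V. Šverák, J. Funct. Anal. 260 (2011) = arXiv:0911.0500, §1 (unit viscosity).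
* T. Tao, Anal. PDE 6 (2013) = arXiv:1108.1165, footnote 3.
* G. Seregin, *Lecture Notes on Regularity Theory for the Navier–Stokes Equations* (2014),
  App. B, Def. B.1 [Seregin2014Notes].
* P. G. Lemarié-Rieusset, *The Navier–Stokes Problem in the 21st Century* (2016), Prop. 15.1.
-/

noncomputable section

open MeasureTheory TopologicalSpace Set Function Filter Metric
open _root_.Topology
open scoped ENNReal NNReal RealInnerProductSpace

namespace Literature.Analysis.FluidPDE

/-! ### The time dilation `Φ(s, y) = (ν s, y)` on strips and boxes -/

/-- The time dilation `Φ(s, y) = (ν s, y)` pulls the open slab `(0, νT) × ℝ³` back to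
`(0, T) × ℝ³` (`ν > 0`). [folklore] -/
theorem stPreimage_time_slab_Ioo {ν : ℝ} (hν : 0 < ν) (T : ℝ) :
    stPreimage ν 1 0 (0 : EuclideanSpace ℝ (Fin 3)) (slab (EuclideanSpace ℝ (Fin 3)) (Ioo 0 (ν * T)) isOpen_Ioo) = slab (EuclideanSpace ℝ (Fin 3)) (Ioo 0 T) isOpen_Ioo := by
  ext z
  simp only [coe_stPreimage, mem_preimage, SetLike.mem_coe, mem_slab, stAffine_fst, zero_add,
    mem_Ioo]
  constructor
  · rintro ⟨h1, h2⟩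
    exact ⟨(mul_pos_iff_of_pos_left hν).1 h1, lt_of_mul_lt_mul_left h2 hν.le⟩
  · rintro ⟨h1, h2⟩
    exact ⟨mul_pos hν h1, mul_lt_mul_of_pos_left h2 hν⟩

/-! ### Local energy solutions under the viscosity scaling -/

/-- **Covariance of Seregin's local energy solutions under the viscosity scaling**
(Rusin–Šverák 2011, §1; Tao 2013, footnote 3; Seregin 2014, Def. B.1 is written with `ν = 1`,
Lemarié-Rieusset's Def. 14.1 / Prop. 15.1 for any `ν > 0`). If `(V, Q)` is a local energy
solution with viscosity `1` and datum `V₀` on the strip `ℝ³ × (0, νT)`, then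
`v(t, x) = ν V(ν t, x)`, `π(t, x) = ν² Q(ν t, x)` is a local energy solution with viscosity `ν`
and datum `ν V₀` on `ℝ³ × (0, T)`: suitability and the weak spatial gradient are covariant
(`IsSuitableWeakSolutionOn.stRescale`, `HasWeakSpatialGradientOn.stRescale` with space dilation
`1`), the pressure class, the gradient bound and the decay are transported by the change of
variables `t = ν s` on boxes, the every-time unit-ball bounds, slice measurability, weak
continuity on the closed interval and the attainment of the datum slice by slice. [cite: RusinSverak2011, §1 (arXiv:0911.0500 p. 3, unit viscosity)] -/
theorem IsLocalEnergySolutionOn.viscosityRescale {T ν : ℝ} {V₀ : (EuclideanSpace ℝ (Fin 3)) → (EuclideanSpace ℝ (Fin 3))} {V : ℝ → (EuclideanSpace ℝ (Fin 3)) → (EuclideanSpace ℝ (Fin 3))}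
    {Q : ℝ → (EuclideanSpace ℝ (Fin 3)) → ℝ} (h : IsLocalEnergySolutionOn (ν * T) 1 V₀ V Q) (hν : 0 < ν) :
    IsLocalEnergySolutionOn T ν (ν • V₀) (ν • stPull ν 1 0 (0 : EuclideanSpace ℝ (Fin 3)) V)
      (ν ^ 2 • stPull ν 1 0 (0 : EuclideanSpace ℝ (Fin 3)) Q) := by
  have hβ : ν = ν * 1 := (mul_one ν).symm
  have hn : Module.finrank ℝ (EuclideanSpace ℝ (Fin 3)) = 3 := finrank_euclideanSpace_fin
  -- the Jacobian constant of `Φ(s, y) = (ν s, y)`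
  have hJ : ENNReal.ofReal (ν * (1 : ℝ) ^ Module.finrank ℝ (EuclideanSpace ℝ (Fin 3)))⁻¹ = ENNReal.ofReal ν⁻¹ := by
    rw [one_pow, mul_one]
  -- pointwise form of the rescaled velocity
  have hv : ∀ t x, (ν • stPull ν 1 0 (0 : EuclideanSpace ℝ (Fin 3)) V) t x = ν • V (ν * t) x := fun t x => by
    rw [smul_stPull_apply, zero_add, zero_add, one_smul]
  have hvfun : ∀ t, (ν • stPull ν 1 0 (0 : EuclideanSpace ℝ (Fin 3)) V) t = fun x => ν • V (ν * t) x := fun t =>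
    funext (hv t)
  -- times in `[0, T]` go to times in `[0, νT]`
  have hIcc : ∀ {t : ℝ}, t ∈ Icc 0 T → ν * t ∈ Icc 0 (ν * T) := fun ht =>
    ⟨mul_nonneg hν.le ht.1, mul_le_mul_of_nonneg_left ht.2 hν.le⟩
  obtain ⟨C, hC⟩ := h.uniformLocalEnergy
  obtain ⟨G, hG, CG, hCG⟩ := h.uniformLocalGradient
  refine
    { suitable := ?_
      pressure := ?_
      sliceMeasurable := ?_
      uniformLocalEnergy := ?_
      uniformLocalGradient := ?_
      weakContinuous := ?_
      initial := ?_
      decay := ?_ }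
  · -- (B.1.5), (B.1.8): suitability is covariant
    have hs := h.suitable.stRescale hν one_pos hβ 0 (0 : EuclideanSpace ℝ (Fin 3))
    rw [stPreimage_time_slab_Ioo hν, mul_one, div_one] at hs
    have hf : ((ν ^ 2 * (1 : ℝ)) • stPull ν 1 0 (0 : EuclideanSpace ℝ (Fin 3)) (0 : ℝ → (EuclideanSpace ℝ (Fin 3)) → (EuclideanSpace ℝ (Fin 3)))) = 0 := by
      funext s y
      simp [stPull]
    rw [hf] at hs
    exact hs
  · -- (B.1.4): the pressure class on `(0, T) × K`
    intro K hK
    have h1 := setLIntegral_enorm_rpow_stRescale hν one_pos 0 (0 : EuclideanSpace ℝ (Fin 3)) (ν ^ 2) Q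
      (Ioo (ν * 0) (ν * T) ×ˢ K) (r := 3 / 2) (by norm_num)
    rw [stAffine_preimage_Ioo_prod hν _ _ _, hJ, mul_zero] at h1
    rw [h1]
    exact ENNReal.mul_lt_top (ENNReal.mul_lt_top
      (ENNReal.rpow_lt_top_of_nonneg (by norm_num) enorm_ne_top) ENNReal.ofReal_lt_top)
      (h.pressure K hK)
  · -- slices are measurable
    intro t ht
    rw [hvfun t]
    exact (h.sliceMeasurable (ν * t) (hIcc ht)).const_smul ν
  · -- (B.1.4): the every-time unit-ball bound
    set C₁ : ℝ≥0∞ := ‖ν‖ₑ ^ 2 * C with hC₁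
    have hC₁top : C₁ ≠ ∞ := ENNReal.mul_ne_top (ENNReal.pow_ne_top enorm_ne_top) ENNReal.coe_ne_top
    refine ⟨C₁.toNNReal, fun t ht x₀ => ?_⟩
    rw [ENNReal.coe_toNNReal hC₁top]
    have e1 : ∀ x, ‖(ν • stPull ν 1 0 (0 : EuclideanSpace ℝ (Fin 3)) V) t x‖ₑ ^ 2 = ‖ν‖ₑ ^ 2 * ‖V (ν * t) x‖ₑ ^ 2 :=
      fun x => by rw [hv, enorm_smul, mul_pow]
    simp_rw [e1]
    rw [lintegral_const_mul' _ _ (ENNReal.pow_ne_top enorm_ne_top)]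
    exact mul_le_mul' le_rfl (hC (ν * t) (hIcc ht) x₀)
  · -- (B.1.4): the weak spatial gradient `ν ∇V(ν ·, ·)` and its unit-box bound
    refine ⟨(ν * 1) • stPull ν 1 0 (0 : EuclideanSpace ℝ (Fin 3)) G, ?_, ?_⟩
    · have h1 := hG.stRescale ν hν one_pos 0 (0 : EuclideanSpace ℝ (Fin 3))
      rw [stPreimage_time_slab_Ioo hν] at h1
      exact h1
    · set C₁ : ℝ≥0∞ := ENNReal.ofReal ((ν * 1) ^ 2) * ENNReal.ofReal ν⁻¹ * CG with hC₁
      have hC₁top : C₁ ≠ ∞ :=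
        ENNReal.mul_ne_top (ENNReal.mul_ne_top ENNReal.ofReal_ne_top ENNReal.ofReal_ne_top)
          ENNReal.coe_ne_top
      refine ⟨C₁.toNNReal, fun x₀ => ?_⟩
      rw [ENNReal.coe_toNNReal hC₁top]
      have h1 := setLIntegral_frobeniusNormSq_stRescale hν one_pos 0 (0 : EuclideanSpace ℝ (Fin 3)) (ν * 1) G
        (Ioo (ν * 0) (ν * T) ×ˢ ball x₀ 1)
      rw [stAffine_preimage_Ioo_prod hν _ _ _, hJ, mul_zero] at h1
      rw [h1]
      exact mul_le_mul' le_rfl (hCG x₀)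
  · -- (B.1.6): weak continuity on the closed interval `[0, T]`
    intro φ hφ
    have e1 : (fun t => ∫ x, ⟪(ν • stPull ν 1 0 (0 : EuclideanSpace ℝ (Fin 3)) V) t x, φ x⟫) =
        fun t => ν * ∫ x, ⟪V (ν * t) x, φ x⟫ := by
      funext t
      simp_rw [hv, real_inner_smul_left, integral_const_mul]
    rw [e1]
    have hmap : MapsTo (fun t : ℝ => ν * t) (Icc 0 T) (Icc 0 (ν * T)) := fun t ht => hIcc ht
    exact ((h.weakContinuous φ hφ).comp (continuous_const_mul ν).continuousOn hmap).const_smul ν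
  · -- (B.1.7): the datum `ν V₀` is attained in `L²_loc`
    intro K hK
    have e1 : ∀ t, ∫⁻ x in K, ‖(ν • stPull ν 1 0 (0 : EuclideanSpace ℝ (Fin 3)) V) t x - (ν • V₀) x‖ₑ ^ 2 =
        ‖ν‖ₑ ^ 2 * ∫⁻ x in K, ‖V (ν * t) x - V₀ x‖ₑ ^ 2 := by
      intro t
      have e2 : ∀ x, ‖(ν • stPull ν 1 0 (0 : EuclideanSpace ℝ (Fin 3)) V) t x - (ν • V₀) x‖ₑ ^ 2 =
          ‖ν‖ₑ ^ 2 * ‖V (ν * t) x - V₀ x‖ₑ ^ 2 := fun x => by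
        rw [hv, Pi.smul_apply, ← smul_sub, enorm_smul, mul_pow]
      simp_rw [e2]
      rw [lintegral_const_mul' _ _ (ENNReal.pow_ne_top enorm_ne_top)]
    simp_rw [e1]
    have hmap : Tendsto (fun t : ℝ => ν * t) (𝓝[>] (0 : ℝ)) (𝓝[>] (0 : ℝ)) := by
      have h1 : Tendsto (fun t : ℝ => ν * t) (𝓝 0) (𝓝 (ν * 0)) :=
        (continuous_const_mul ν).tendsto 0
      rw [mul_zero] at h1
      refine tendsto_nhdsWithin_of_tendsto_nhds_of_eventually_within _
        (h1.mono_left nhdsWithin_le_nhds) ?_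
      filter_upwards [self_mem_nhdsWithin] with t ht
      exact mul_pos hν ht
    have h2 := (h.initial K hK).comp hmap
    have h3 := ENNReal.Tendsto.const_mul h2 (Or.inr (ENNReal.pow_ne_top enorm_ne_top) :
      (0 : ℝ≥0∞) ≠ 0 ∨ ‖ν‖ₑ ^ 2 ≠ ∞)
    rw [mul_zero] at h3
    exact h3
  · -- decay at spatial infinity on the strip
    intro R hR
    have hbound : ∀ x₀ : (EuclideanSpace ℝ (Fin 3)),
        ∫⁻ z in Ioo 0 T ×ˢ ball x₀ R, ‖(ν • stPull ν 1 0 (0 : EuclideanSpace ℝ (Fin 3)) V) z.1 z.2‖ₑ ^ 2 =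
          ‖ν‖ₑ ^ 2 * ENNReal.ofReal ν⁻¹ *
            ∫⁻ z in Ioo 0 (ν * T) ×ˢ ball x₀ R, ‖V z.1 z.2‖ₑ ^ 2 := by
      intro x₀
      have h1 := setLIntegral_enorm_pow_stRescale hν one_pos 0 (0 : EuclideanSpace ℝ (Fin 3)) ν V
        (Ioo (ν * 0) (ν * T) ×ˢ ball x₀ R) 2
      rw [stAffine_preimage_Ioo_prod hν _ _ _, hJ, mul_zero] at h1
      exact h1
    simp_rw [hbound]
    have h2 := ENNReal.Tendsto.const_mul (h.decay R hR)
      (Or.inr (ENNReal.mul_ne_top (ENNReal.pow_ne_top enorm_ne_top) ENNReal.ofReal_ne_top) :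
        (0 : ℝ≥0∞) ≠ 0 ∨ ‖ν‖ₑ ^ 2 * ENNReal.ofReal ν⁻¹ ≠ ∞)
    rw [mul_zero] at h2
    exact h2

end Literature.Analysis.FluidPDE

end
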